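import Summits.ValiantsHypothesis.ValiantsHypothesis.Theorems.DivisionGapDefs

/-!
# Stub `stub_heavyLines` for `DivisionGap.PerDivisionHard` (line pair-descent-jss-endpoint, v14)

Mode selection on an `n × n` grid, by double counting.  A set `Y` of cells is *balanced*
if `n² / 4 ≤ |Y| ≤ 3 n² / 4`.  A column `c` is *live* (for a threshold `N` with
`64 N ≤ n`) if it has more than `N` cells in `Y` and more than `N` cells outside `Y`;
similarly for rows.  Then a balanced `Y` has at least `n / 8` live columns or at least
`n / 8` live rows.

Proof sketch.  Suppose both fail.  A non-live line has at most `N` cells in `Y`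
("`1`-light") or at most `N` cells outside `Y` ("`0`-light").  Counting the cells of `Y`
in the rectangle (`1`-light rows) × (`0`-light columns) row by row and column by column
shows that there are at most `2 N` `1`-light rows or at most `2 N` `0`-light columns.  In
the first case more than `7 n / 8 - 2 N` rows are `0`-light, each carrying at least `n - N`
cells of `Y`, which exceeds `3 n² / 4` cells; the second case is symmetric with the cells
outside `Y` and the lower bound `n² / 4 ≤ |Y|`.

[folklore] — proof spelled out in this formalization.
-/

noncomputable section

set_option linter.dupNamespace false

namespace Summit.ValiantsHypothesis.ValiantsHypothesis.Theorems.DivisionGapPerDivisionHard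

open Finset

variable {n : ℕ}

/-- In each row, the cells inside `Y` and the cells outside `Y` number `n` in total.
[folklore] -/
private theorem hl_row_split (Y : Finset (Fin n × Fin n)) (r : Fin n) :
    (univ.filter fun c : Fin n => (r, c) ∈ Y).card +
      (univ.filter fun c : Fin n => (r, c) ∉ Y).card = n := by
  rw [card_filter_add_card_filter_not, card_univ, Fintype.card_fin]

/-- In each column, the cells outside `Y` and the cells inside `Y` number `n` in total.
[folklore] -/
private theorem hl_col_split (Y : Finset (Fin n × Fin n)) (c : Fin n) :
    (univ.filter fun r : Fin n => (r, c) ∉ Y).card +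
      (univ.filter fun r : Fin n => (r, c) ∈ Y).card = n := by
  rw [add_comm, card_filter_add_card_filter_not, card_univ, Fintype.card_fin]

/-- `Y` is partitioned by rows: `|Y|` is the sum over rows of the row counts. [folklore] -/
private theorem hl_card_eq_sum_rows (Y : Finset (Fin n × Fin n)) :
    Y.card = ∑ r : Fin n, (univ.filter fun c : Fin n => (r, c) ∈ Y).card := by
  calc Y.card = (univ.filter fun p : Fin n × Fin n => p ∈ Y).card := by rw [filter_univ_mem]
    _ = ∑ p : Fin n × Fin n, if p ∈ Y then 1 else 0 := card_filter _ _
    _ = ∑ r : Fin n, ∑ c : Fin n, if (r, c) ∈ Y then 1 else 0 := Fintype.sum_prod_type _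
    _ = ∑ r : Fin n, (univ.filter fun c : Fin n => (r, c) ∈ Y).card :=
        sum_congr rfl (fun r _ => (card_filter _ _).symm)

/-- `Y` is partitioned by columns: `|Y|` is the sum over columns of the column counts.
[folklore] -/
private theorem hl_card_eq_sum_cols (Y : Finset (Fin n × Fin n)) :
    Y.card = ∑ c : Fin n, (univ.filter fun r : Fin n => (r, c) ∈ Y).card := by
  calc Y.card = (univ.filter fun p : Fin n × Fin n => p ∈ Y).card := by rw [filter_univ_mem]
    _ = ∑ p : Fin n × Fin n, if p ∈ Y then 1 else 0 := card_filter _ _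
    _ = ∑ c : Fin n, ∑ r : Fin n, if (r, c) ∈ Y then 1 else 0 := Fintype.sum_prod_type_right _
    _ = ∑ c : Fin n, (univ.filter fun r : Fin n => (r, c) ∈ Y).card :=
        sum_congr rfl (fun c _ => (card_filter _ _).symm)

/-- The cells outside `Y`, counted column by column, together with `|Y|` make up the whole
grid of `n * n` cells. [folklore] -/
private theorem hl_sum_col_zeros (Y : Finset (Fin n × Fin n)) :
    (∑ c : Fin n, (univ.filter fun r : Fin n => (r, c) ∉ Y).card) + Y.card = n * n := by
  rw [hl_card_eq_sum_cols Y, ← sum_add_distrib, sum_congr rfl (fun c _ => hl_col_split Y c),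
    sum_const, card_univ, Fintype.card_fin, smul_eq_mul]

/-- Double counting the cells of `Y` in a rectangle `R × C` whose rows each have at most `N`
cells in `Y` and whose columns each have at most `N` cells outside `Y`: row by row there are
at most `|R| N` such cells, column by column at least `|C| (|R| - N)`. [folklore] -/
private theorem hl_rect_count (N : ℕ) (Y : Finset (Fin n × Fin n)) (R C : Finset (Fin n))
    (hR : ∀ r ∈ R, (univ.filter fun c : Fin n => (r, c) ∈ Y).card ≤ N)
    (hC : ∀ c ∈ C, (univ.filter fun r : Fin n => (r, c) ∉ Y).card ≤ N) :
    R.card * C.card ≤ R.card * N + C.card * N := by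
  -- upper bound: row by row
  have hup : (∑ r ∈ R, ∑ c ∈ C, if (r, c) ∈ Y then 1 else 0) ≤ R.card * N := by
    have hrow : ∀ r ∈ R, (∑ c ∈ C, if (r, c) ∈ Y then 1 else 0) ≤ N := by
      intro r hr
      have e : (∑ c ∈ C, if (r, c) ∈ Y then 1 else 0) = (C.filter fun c => (r, c) ∈ Y).card :=
        (card_filter _ _).symm
      rw [e]
      exact (card_le_card (filter_subset_filter _ (subset_univ C))).trans (hR r hr)
    calc (∑ r ∈ R, ∑ c ∈ C, if (r, c) ∈ Y then 1 else 0) ≤ ∑ _r ∈ R, N := sum_le_sum hrow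
      _ = R.card * N := by rw [sum_const, smul_eq_mul]
  -- lower bound: column by column
  have hlow : C.card * R.card ≤
      (∑ r ∈ R, ∑ c ∈ C, if (r, c) ∈ Y then 1 else 0) + C.card * N := by
    rw [sum_comm]
    have hcol : ∀ c ∈ C, R.card ≤ (∑ r ∈ R, if (r, c) ∈ Y then 1 else 0) + N := by
      intro c hc
      have e : (∑ r ∈ R, if (r, c) ∈ Y then 1 else 0) = (R.filter fun r => (r, c) ∈ Y).card :=
        (card_filter _ _).symm
      rw [e]
      have hsplit : (R.filter fun r => (r, c) ∈ Y).card +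
          (R.filter fun r => (r, c) ∉ Y).card = R.card :=
        card_filter_add_card_filter_not _
      have hz : (R.filter fun r => (r, c) ∉ Y).card ≤ N :=
        (card_le_card (filter_subset_filter _ (subset_univ R))).trans (hC c hc)
      omega
    calc C.card * R.card = ∑ _c ∈ C, R.card := by rw [sum_const, smul_eq_mul]
      _ ≤ ∑ c ∈ C, ((∑ r ∈ R, if (r, c) ∈ Y then 1 else 0) + N) := sum_le_sum hcol
      _ = (∑ c ∈ C, ∑ r ∈ R, if (r, c) ∈ Y then 1 else 0) + C.card * N := by
          rw [sum_add_distrib, sum_const, smul_eq_mul]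
  calc R.card * C.card = C.card * R.card := mul_comm _ _
    _ ≤ _ := hlow
    _ ≤ R.card * N + C.card * N := Nat.add_le_add_right hup _

/-- If `a b ≤ a N + b N` then `a ≤ 2 N` or `b ≤ 2 N`. [folklore] -/
private theorem hl_le_two_mul_or {a b N : ℕ} (h : a * b ≤ a * N + b * N) :
    a ≤ 2 * N ∨ b ≤ 2 * N := by
  by_contra hc
  rw [not_or, not_le, not_le] at hc
  have ha : 2 * N + 1 ≤ a := by omega
  have hb : 2 * N + 1 ≤ b := by omega
  have h1 : (2 * N + 1) * b ≤ a * b := Nat.mul_le_mul_right b ha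
  have h2 : a * (2 * N + 1) ≤ a * b := Nat.mul_le_mul_left a hb
  nlinarith [h1, h2, ha, hb, h]

/-- Core count on `n` lines.  Line `i` has `f i` marked and `g i` unmarked cells
(`f i + g i = n`); it is *live* if both counts exceed `N`.  If fewer than `n / 8` lines are
live and at most `2 N` lines have at most `N` marked cells, then (as `64 N ≤ n`) more than
`7 n / 8 - 2 N` lines have at least `n - N` marked cells each, which is incompatible with at
most `3 n² / 4` marked cells in total. [folklore] -/
private theorem hl_lines_core (N : ℕ) (f g : Fin n → ℕ) (hfg : ∀ i, f i + g i = n)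
    (hsum : 4 * ∑ i, f i ≤ 3 * (n * n)) (hN : 64 * N ≤ n) (hn : 0 < n)
    (hlive : 8 * (univ.filter fun i => N < f i ∧ N < g i).card < n)
    (hfew : (univ.filter fun i => f i ≤ N).card ≤ 2 * N) : False := by
  -- every line is live, or has few marked cells, or has few unmarked cells
  have hcover : (univ : Finset (Fin n)) ⊆
      (univ.filter fun i => N < f i ∧ N < g i) ∪ (univ.filter fun i => f i ≤ N) ∪
        (univ.filter fun i => g i ≤ N) := by
    intro i _
    simp only [mem_union, mem_filter, mem_univ, true_and]
    omega
  have hn_le : n ≤ (univ.filter fun i => N < f i ∧ N < g i).card +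
      (univ.filter fun i => f i ≤ N).card + (univ.filter fun i => g i ≤ N).card := by
    have h := (card_le_card hcover).trans
      ((card_union_le _ _).trans (Nat.add_le_add_right (card_union_le _ _) _))
    rwa [card_univ, Fintype.card_fin] at h
  have ha_le : (univ.filter fun i => g i ≤ N).card ≤ n := by
    have h := card_filter_le (univ : Finset (Fin n)) (fun i => g i ≤ N)
    rwa [card_univ, Fintype.card_fin] at h
  -- the lines with few unmarked cells carry at least `n - N` marked cells each
  have h1 : ∑ i ∈ univ.filter (fun j => g j ≤ N), f i ≤ ∑ i, f i :=
    sum_le_sum_of_subset (filter_subset _ _)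
  have h2 : ∑ i ∈ univ.filter (fun j => g j ≤ N), g i ≤
      (univ.filter fun i => g i ≤ N).card * N := by
    have h := sum_le_card_nsmul (univ.filter fun j => g j ≤ N) g N
      (fun i hi => (mem_filter.mp hi).2)
    rwa [smul_eq_mul] at h
  have h3 : ∑ i ∈ univ.filter (fun j => g j ≤ N), f i + ∑ i ∈ univ.filter (fun j => g j ≤ N), g i
      = (univ.filter fun i => g i ≤ N).card * n := by
    rw [← sum_add_distrib, sum_congr rfl (fun i _ => hfg i), sum_const, smul_eq_mul]
  have key : (univ.filter fun i => g i ≤ N).card * n ≤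
      (∑ i, f i) + (univ.filter fun i => g i ≤ N).card * N := by
    omega
  -- arithmetic
  have h7 : 7 * n + 1 ≤ 16 * N + 8 * (univ.filter fun i => g i ≤ N).card := by omega
  have p1 : (7 * n + 1) * n ≤ (16 * N + 8 * (univ.filter fun i => g i ≤ N).card) * n :=
    Nat.mul_le_mul_right n h7
  have p2 : (univ.filter fun i => g i ≤ N).card * N ≤ n * N := Nat.mul_le_mul_right N ha_le
  have p3 : 64 * N * n ≤ n * n := Nat.mul_le_mul_right n hN
  have p4 : n ≤ n * n := Nat.le_mul_self n
  nlinarith [key, hsum, p1, p2, p3, p4, hn]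

/-- Mode selection (stub A of rung v14). A balanced `Y` (`n² / 4 ≤ |Y| ≤ 3 n² / 4`) with
`64 N ≤ n` has at least `n / 8` live columns (more than `N` cells in `Y` and more than `N`
cells outside `Y`) or at least `n / 8` live rows. [folklore] -/
theorem stub_heavyLines :
    ∀ (n N : ℕ) (Y : Finset (Fin n × Fin n)), n * n ≤ 4 * Y.card → 4 * Y.card ≤ 3 * (n * n) →
      64 * N ≤ n → 0 < n →
      n ≤ 8 * (Finset.univ.filter fun c : Fin n =>
          N < (Finset.univ.filter fun r : Fin n => (r, c) ∈ Y).card ∧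
          N < (Finset.univ.filter fun r : Fin n => (r, c) ∉ Y).card).card ∨
      n ≤ 8 * (Finset.univ.filter fun r : Fin n =>
          N < (Finset.univ.filter fun c : Fin n => (r, c) ∈ Y).card ∧
          N < (Finset.univ.filter fun c : Fin n => (r, c) ∉ Y).card).card := by
  intro n N Y hlo hhi hN hn
  by_contra hcon
  rw [not_or, not_le, not_le] at hcon
  obtain ⟨hcol, hrow⟩ := hcon
  -- double count on (`1`-light rows) × (`0`-light columns)
  have hrect := hl_rect_count N Y
    (univ.filter fun r : Fin n => (univ.filter fun c : Fin n => (r, c) ∈ Y).card ≤ N)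
    (univ.filter fun c : Fin n => (univ.filter fun r : Fin n => (r, c) ∉ Y).card ≤ N)
    (fun r hr => (mem_filter.mp hr).2) (fun c hc => (mem_filter.mp hc).2)
  rcases hl_le_two_mul_or hrect with hR | hC
  · -- few `1`-light rows: count the cells of `Y` row by row
    have hs : 4 * ∑ r : Fin n, (univ.filter fun c : Fin n => (r, c) ∈ Y).card ≤ 3 * (n * n) := by
      rw [← hl_card_eq_sum_rows Y]
      exact hhi
    exact hl_lines_core N (fun r => (univ.filter fun c : Fin n => (r, c) ∈ Y).card)
      (fun r => (univ.filter fun c : Fin n => (r, c) ∉ Y).card) (hl_row_split Y) hs hN hn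
      hrow hR
  · -- few `0`-light columns: count the cells outside `Y` column by column
    have hs : 4 * ∑ c : Fin n, (univ.filter fun r : Fin n => (r, c) ∉ Y).card ≤ 3 * (n * n) := by
      have h := hl_sum_col_zeros Y
      omega
    have e : (univ.filter fun c : Fin n =>
          N < (univ.filter fun r : Fin n => (r, c) ∉ Y).card ∧
          N < (univ.filter fun r : Fin n => (r, c) ∈ Y).card) =
        (univ.filter fun c : Fin n =>
          N < (univ.filter fun r : Fin n => (r, c) ∈ Y).card ∧
          N < (univ.filter fun r : Fin n => (r, c) ∉ Y).card) :=
      filter_congr (fun _ _ => and_comm)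
    have hlive : 8 * (univ.filter fun c : Fin n =>
        N < (univ.filter fun r : Fin n => (r, c) ∉ Y).card ∧
        N < (univ.filter fun r : Fin n => (r, c) ∈ Y).card).card < n := by
      rw [e]
      exact hcol
    exact hl_lines_core N (fun c => (univ.filter fun r : Fin n => (r, c) ∉ Y).card)
      (fun c => (univ.filter fun r : Fin n => (r, c) ∈ Y).card) (hl_col_split Y) hs hN hn
      hlive hC

end Summit.ValiantsHypothesis.ValiantsHypothesis.Theorems.DivisionGapPerDivisionHard
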